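import Summits.FinalStateConjecture.FinalStateConjecture.Theorems.EIHFluxBalanceInertialRecessionBoostAlgebra

/-!
# Route EIHFluxBalance — `InertialRecession`: eventual smallness of the painted kinematics

Helper file for the crux `stmt-FinalStateConjecture-10166`
(`Summit.FinalStateConjecture.FinalStateConjecture.Theses.EIHFluxBalance.InertialRecession`).

The near-zone estimate of the `a = 0` hole charts (`…HoleTransport`) consumes, at a late lab time
`w`, smallness `≤ δ₀` of: `ξ'(w) − V`, `ξ''(w)`, `ξ'''(w)`, the first three derivatives of
`s ↦ L_{v(s)}` at `w`, `L_{v(w)} − L_V`, `boost(−v(w)) − boost(−V)`, the first two derivatives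
of `s ↦ boost(−v(s))`, and a bound `‖boost(−v(w))‖ ≤ C_a`. This file derives all of them,
eventually in `w`, from the kinematic conclusions of the line's dynamics
(`v → V`, `ξ' → V`, `v⁽ˡ⁾ → 0` for `l = 1, 2, 3`, `ξ⁽ˡ⁾ → 0` for `l = 2, 3`, `‖v‖ ≤ κ₀ < 1`):
* `exists_smallDeriv_comp` — Faà di Bruno smallness: for `g` smooth on the unit ball,
  `‖(g ∘ w)⁽ˡ⁾(t)‖ ≤ C d` (`1 ≤ l ≤ 3`) as soon as `‖w⁽ʲ⁾(t)‖ ≤ dʲ` (`1 ≤ j ≤ 3`, `d ≤ 1`);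
* `eventually_kinematics_small'` (registered form unprimed) — the eventual `δ₀`-smallness package.
-/

noncomputable section

open scoped Topology ContDiff InnerProductSpace
open Filter Set Metric Function TopologicalSpace Literature.Geometry.Lorentzian

namespace Summit.FinalStateConjecture.FinalStateConjecture.Theorems

/-- **Faà di Bruno smallness.** For `g` smooth on the open unit ball of `E3` and a speed bound
`κ₀ < 1` there is `C ≥ 0` such that for every `C³` path `w` with `‖w‖ ≤ κ₀` and
`‖w⁽ʲ⁾(t)‖ ≤ dʲ` (`1 ≤ j ≤ 3`, `0 ≤ d ≤ 1`): `‖(g ∘ w)⁽ˡ⁾(t)‖ ≤ C d` for `1 ≤ l ≤ 3`, and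
`‖g(w(t))‖ ≤ C`. [folklore] -/
theorem exists_smallDeriv_comp {F : Type*} [NormedAddCommGroup F] [NormedSpace ℝ F] {g : E3 → F}
    (hg : ContDiffOn ℝ ∞ g (ball (0 : E3) 1)) {κ₀ : ℝ} (hκ₀ : κ₀ < 1) :
    ∃ C : ℝ, 0 ≤ C ∧ ∀ (w : ℝ → E3) (t d : ℝ), ContDiff ℝ 3 w → (∀ s, ‖w s‖ ≤ κ₀) → 0 ≤ d → d ≤ 1 →
      (∀ j, 1 ≤ j → j ≤ 3 → ‖iteratedDeriv j w t‖ ≤ d ^ j) →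
      (∀ l, 1 ≤ l → l ≤ 3 → ‖iteratedDeriv l (fun s ↦ g (w s)) t‖ ≤ C * d) ∧ ‖g (w t)‖ ≤ C := by
  have hOo : IsOpen (ball (0 : E3) 1) := isOpen_ball
  have hKc : IsCompact (closedBall (0 : E3) κ₀) := isCompact_closedBall _ _
  have hKO : closedBall (0 : E3) κ₀ ⊆ ball 0 1 := closedBall_subset_ball hκ₀
  have hbound : ∀ i : ℕ, ∃ C : ℝ, ∀ u ∈ closedBall (0 : E3) κ₀, ‖iteratedFDeriv ℝ i g u‖ ≤ C := by
    intro i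
    have h1 := hg.continuousOn_iteratedFDerivWithin (m := i) (by exact_mod_cast le_top)
      hOo.uniqueDiffOn
    have h2 := h1.congr (g := iteratedFDeriv ℝ i g)
      fun p hp ↦ (iteratedFDerivWithin_of_isOpen i hOo hp).symm
    obtain ⟨C, hC⟩ := hKc.exists_bound_of_continuousOn (h2.mono hKO)
    exact ⟨C, hC⟩
  choose C hC using hbound
  set Cmax : ℝ := ∑ i ∈ Finset.range 4, |C i| with hCmax
  have hCmax0 : 0 ≤ Cmax := Finset.sum_nonneg fun _ _ ↦ abs_nonneg _
  have hCi : ∀ i ≤ 3, ∀ u ∈ closedBall (0 : E3) κ₀, ‖iteratedFDeriv ℝ i g u‖ ≤ Cmax :=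
    fun i hi u hu ↦ ((hC i u hu).trans (le_abs_self _)).trans
      (Finset.single_le_sum (f := fun i ↦ |C i|) (fun _ _ ↦ abs_nonneg _)
        (Finset.mem_range.mpr (by omega)))
  refine ⟨6 * Cmax, by positivity, fun w t d hw hws hd0 hd1 hwb ↦ ⟨fun l hl1 hl3 ↦ ?_, ?_⟩⟩
  · have hwt : w t ∈ closedBall (0 : E3) κ₀ := by simpa using hws t
    set s : Set ℝ := w ⁻¹' ball (0 : E3) 1 with hs
    have hso : IsOpen s := hOo.preimage hw.continuous
    have hts : t ∈ s := hKO hwt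
    have hcomp := norm_iteratedFDerivWithin_comp_le (g := g) (f := w) (n := l)
      (N := ((3 : ℕ∞) : WithTop ℕ∞)) (x := t) (hg.of_le (by exact_mod_cast le_top)) hw.contDiffOn
      (by exact_mod_cast hl3) hOo.uniqueDiffOn hso.uniqueDiffOn (fun y hy ↦ hy) hts (C := Cmax) (D := d)
      (fun i hi ↦ by
        rw [iteratedFDerivWithin_of_isOpen i hOo (hKO hwt)]
        exact hCi i (hi.trans hl3) (w t) hwt)
      (fun i hi1 hij ↦ by
        rw [iteratedFDerivWithin_of_isOpen i hso hts, norm_iteratedFDeriv_eq_norm_iteratedDeriv]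
        exact hwb i hi1 (hij.trans hl3))
    rw [iteratedFDerivWithin_of_isOpen l hso hts] at hcomp
    rw [← norm_iteratedFDeriv_eq_norm_iteratedDeriv]
    refine hcomp.trans ?_
    have h1 : (l.factorial : ℝ) ≤ 6 := by
      interval_cases l <;> norm_num [Nat.factorial]
    have h2 : d ^ l ≤ d := by
      obtain ⟨k, rfl⟩ := Nat.exists_eq_add_of_le' hl1
      rw [pow_succ]
      exact mul_le_of_le_one_left hd0 (pow_le_one₀ hd0 hd1)
    calc (l.factorial : ℝ) * Cmax * d ^ l ≤ 6 * Cmax * d :=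
          mul_le_mul (mul_le_mul_of_nonneg_right h1 hCmax0) h2 (pow_nonneg hd0 l) (by positivity)
      _ = 6 * Cmax * d := rfl
  · have hwt : w t ∈ closedBall (0 : E3) κ₀ := by simpa using hws t
    have h := hCi 0 (by norm_num) (w t) hwt
    rw [norm_iteratedFDeriv_zero] at h
    linarith

/-- **Eventual `δ₀`-smallness of the painted kinematics of a hole.** If the painted lab velocity
`v` (`‖v‖ ≤ κ₀ < 1`) tends to `V` with its first three derivatives tending to `0`, and the centre
`ξ` has `ξ' → V`, `ξ'', ξ''' → 0`, then there is `C_a` such that for every `δ₀ > 0`, eventually in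
the lab time `w`: `‖ξ'(w) − V‖`, `‖ξ''(w)‖`, `‖ξ'''(w)‖`, `‖(L_{v(·)})⁽ˡ⁾(w)‖` (`l = 1, 2, 3`),
`‖L_{v(w)} − L_V‖`, `‖boost(−v(w)) − boost(−V)‖`, `‖(boost(−v(·)))⁽ˡ⁾(w)‖` (`l = 1, 2`) are all
`≤ δ₀`, and `‖boost(−v(w))‖ ≤ C_a`. [folklore] -/
theorem eventually_kinematics_small' {v ξ : ℝ → E3} {κ₀ : ℝ} (hκ₀ : κ₀ < 1) (hvs : ∀ t, ‖v t‖ ≤ κ₀)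
    (hv : ContDiff ℝ ∞ v) {V : E3} (hvV : Tendsto v atTop (𝓝 V))
    (hξV : Tendsto (deriv ξ) atTop (𝓝 V))
    (hξ0 : ∀ l, 2 ≤ l → l ≤ 3 → Tendsto (fun t ↦ iteratedDeriv l ξ t) atTop (𝓝 0))
    (hv0 : ∀ l, 1 ≤ l → l ≤ 3 → Tendsto (fun t ↦ iteratedDeriv l v t) atTop (𝓝 0)) :
    ∃ Ca : ℝ, 0 ≤ Ca ∧ ∀ δ₀, 0 < δ₀ → ∀ᶠ w in atTop,
      ‖deriv ξ w - V‖ ≤ δ₀ ∧ (∀ l, 2 ≤ l → l ≤ 3 → ‖iteratedDeriv l ξ w‖ ≤ δ₀) ∧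
      (∀ l, 1 ≤ l → l ≤ 3 → ‖iteratedDeriv l (fun s ↦ ContinuousLinearMap.id ℝ E3 -
        (Lorentz.gamma (v s) / (Lorentz.gamma (v s) + 1)) • (innerSL ℝ (v s)).smulRight (v s)) w‖ ≤ δ₀) ∧
      ‖(ContinuousLinearMap.id ℝ E3 - (Lorentz.gamma (v w) / (Lorentz.gamma (v w) + 1)) •
          (innerSL ℝ (v w)).smulRight (v w)) - (ContinuousLinearMap.id ℝ E3 -
          (Lorentz.gamma V / (Lorentz.gamma V + 1)) • (innerSL ℝ V).smulRight V)‖ ≤ δ₀ ∧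
      ‖Lorentz.boostCLM (-v w) - Lorentz.boostCLM (-V)‖ ≤ δ₀ ∧
      (∀ l, 1 ≤ l → l ≤ 2 → ‖iteratedDeriv l (fun s ↦ Lorentz.boostCLM (-v s)) w‖ ≤ δ₀) ∧
      ‖Lorentz.boostCLM (-v w)‖ ≤ Ca := by
  -- the two smooth maps of the velocity
  set Lf : E3 → E3 →L[ℝ] E3 := fun u ↦ ContinuousLinearMap.id ℝ E3 -
    (Lorentz.gamma u / (Lorentz.gamma u + 1)) • (innerSL ℝ u).smulRight u with hLf
  set bo : E3 → E4 →L[ℝ] E4 := fun u ↦ Lorentz.boostCLM (-u) with hbo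
  have hLfc : ContDiffOn ℝ ∞ Lf (ball (0 : E3) 1) := contDiffOn_restOffsetCLM
  have hboc : ContDiffOn ℝ ∞ bo (ball (0 : E3) 1) := by
    refine contDiffOn_boostCLM.comp contDiff_neg.contDiffOn fun u hu ↦ ?_
    simpa using hu
  obtain ⟨C₁, hC₁0, hC₁⟩ := exists_smallDeriv_comp hLfc hκ₀
  obtain ⟨C₂, hC₂0, hC₂⟩ := exists_smallDeriv_comp hboc hκ₀
  have hv3 : ContDiff ℝ 3 v := hv.of_le (WithTop.coe_le_coe.mpr le_top)
  -- the limit velocity lies in the closed ball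
  have hVκ : ‖V‖ ≤ κ₀ :=
    le_of_tendsto (hvV.norm) (Filter.Eventually.of_forall hvs)
  have hV1 : V ∈ ball (0 : E3) 1 := by simpa using hVκ.trans_lt hκ₀
  -- continuity of the two maps at `V`
  have hLft : Tendsto (fun t ↦ Lf (v t)) atTop (𝓝 (Lf V)) :=
    ((hLfc.continuousOn.continuousAt (isOpen_ball.mem_nhds hV1)).tendsto).comp hvV
  have hbot : Tendsto (fun t ↦ bo (v t)) atTop (𝓝 (bo V)) :=
    ((hboc.continuousOn.continuousAt (isOpen_ball.mem_nhds hV1)).tendsto).comp hvV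
  refine ⟨C₂, hC₂0, fun δ₀ hδ₀ ↦ ?_⟩
  -- the auxiliary scale `d`
  set d : ℝ := min 1 (δ₀ / (C₁ + C₂ + 1)) with hd
  have hd0 : 0 < d := lt_min one_pos (div_pos hδ₀ (by positivity))
  have hd1 : d ≤ 1 := min_le_left _ _
  have hdδ : (C₁ + C₂ + 1) * d ≤ δ₀ := by
    have h1 : d ≤ δ₀ / (C₁ + C₂ + 1) := min_le_right _ _
    have h2 : 0 < C₁ + C₂ + 1 := by positivity
    calc (C₁ + C₂ + 1) * d ≤ (C₁ + C₂ + 1) * (δ₀ / (C₁ + C₂ + 1)) :=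
          mul_le_mul_of_nonneg_left h1 h2.le
      _ = δ₀ := by field_simp
  have hd3 : 0 < d ^ 3 := pow_pos hd0 3
  -- eventual smallness of the primitive quantities
  have e1 : ∀ᶠ w in atTop, ∀ j, 1 ≤ j → j ≤ 3 → ‖iteratedDeriv j v w‖ ≤ d ^ j := by
    have h : ∀ j, 1 ≤ j → j ≤ 3 → ∀ᶠ w in atTop, ‖iteratedDeriv j v w‖ ≤ d ^ j := by
      intro j hj1 hj3
      have := Metric.tendsto_nhds.1 (hv0 j hj1 hj3) (d ^ 3) hd3
      filter_upwards [this] with w hw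
      rw [dist_zero_right] at hw
      refine hw.le.trans ?_
      exact pow_le_pow_of_le_one hd0.le hd1 hj3
    have h1 := h 1 le_rfl (by norm_num)
    have h2 := h 2 (by norm_num) (by norm_num)
    have h3 := h 3 (by norm_num) le_rfl
    filter_upwards [h1, h2, h3] with w w1 w2 w3
    intro j hj1 hj3
    interval_cases j
    · exact w1
    · exact w2
    · exact w3
  have e2 : ∀ᶠ w in atTop, ‖deriv ξ w - V‖ ≤ δ₀ := by
    have := Metric.tendsto_nhds.1 hξV δ₀ hδ₀
    filter_upwards [this] with w hw
    rw [dist_eq_norm] at hw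
    exact hw.le
  have e3 : ∀ᶠ w in atTop, ∀ l, 2 ≤ l → l ≤ 3 → ‖iteratedDeriv l ξ w‖ ≤ δ₀ := by
    have h : ∀ l, 2 ≤ l → l ≤ 3 → ∀ᶠ w in atTop, ‖iteratedDeriv l ξ w‖ ≤ δ₀ := by
      intro l hl2 hl3
      have := Metric.tendsto_nhds.1 (hξ0 l hl2 hl3) δ₀ hδ₀
      filter_upwards [this] with w hw
      rw [dist_zero_right] at hw
      exact hw.le
    have h2 := h 2 le_rfl (by norm_num)
    have h3 := h 3 (by norm_num) le_rfl
    filter_upwards [h2, h3] with w w2 w3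
    intro l hl2 hl3
    interval_cases l
    · exact w2
    · exact w3
  have e4 : ∀ᶠ w in atTop, ‖Lf (v w) - Lf V‖ ≤ δ₀ := by
    have := Metric.tendsto_nhds.1 hLft δ₀ hδ₀
    filter_upwards [this] with w hw
    rw [dist_eq_norm] at hw
    exact hw.le
  have e5 : ∀ᶠ w in atTop, ‖bo (v w) - bo V‖ ≤ δ₀ := by
    have := Metric.tendsto_nhds.1 hbot δ₀ hδ₀
    filter_upwards [this] with w hw
    rw [dist_eq_norm] at hw
    exact hw.le
  filter_upwards [e1, e2, e3, e4, e5] with w w1 w2 w3 w4 w5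
  obtain ⟨hL, -⟩ := hC₁ v w d hv3 hvs hd0.le hd1 w1
  obtain ⟨hB, hB0⟩ := hC₂ v w d hv3 hvs hd0.le hd1 w1
  have hC₁d : C₁ * d ≤ δ₀ := by nlinarith [mul_nonneg hC₂0 hd0.le, hd0]
  have hC₂d : C₂ * d ≤ δ₀ := by nlinarith [mul_nonneg hC₁0 hd0.le, hd0]
  refine ⟨w2, w3, fun l hl1 hl3 ↦ (hL l hl1 hl3).trans hC₁d, w4, w5,
    fun l hl1 hl2 ↦ (hB l hl1 (hl2.trans (by norm_num))).trans hC₂d, hB0⟩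

/-- Registered sub-goal form (stub `eventually_kinematics_small` of the crux item) of
`eventually_kinematics_small'`. [folklore] -/
theorem eventually_kinematics_small : open Literature.Geometry.Lorentzian Filter Topology in ∀ {v ξ : ℝ → E3} {κ₀ : ℝ}, κ₀ < 1 → (∀ t, ‖v t‖ ≤ κ₀) → ContDiff ℝ ((⊤ : ℕ∞) : WithTop ℕ∞) v → ∀ {V : E3}, Tendsto v atTop (𝓝 V) → Tendsto (deriv ξ) atTop (𝓝 V) → (∀ l, 2 ≤ l → l ≤ 3 → Tendsto (fun t ↦ iteratedDeriv l ξ t) atTop (𝓝 0)) → (∀ l, 1 ≤ l → l ≤ 3 → Tendsto (fun t ↦ iteratedDeriv l v t) atTop (𝓝 0)) → ∃ Ca : ℝ, 0 ≤ Ca ∧ ∀ δ₀, 0 < δ₀ → ∀ᶠ w in atTop, ‖deriv ξ w - V‖ ≤ δ₀ ∧ (∀ l, 2 ≤ l → l ≤ 3 → ‖iteratedDeriv l ξ w‖ ≤ δ₀) ∧ (∀ l, 1 ≤ l → l ≤ 3 → ‖iteratedDeriv l (fun s ↦ ContinuousLinearMap.id ℝ E3 - (Lorentz.gamma (v s) /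 (Lorentz.gamma (v s) + 1)) • (innerSL ℝ (v s)).smulRight (v s)) w‖ ≤ δ₀) ∧ ‖(ContinuousLinearMap.id ℝ E3 - (Lorentz.gamma (v w) / (Lorentz.gamma (v w) + 1)) • (innerSL ℝ (v w)).smulRight (v w)) - (ContinuousLinearMap.id ℝ E3 - (Lorentz.gamma V / (Lorentz.gamma V + 1)) • (innerSL ℝ V).smulRight V)‖ ≤ δ₀ ∧ ‖Lorentz.boostCLM (-v w) - Lorentz.boostCLM (-V)‖ ≤ δ₀ ∧ (∀ l, 1 ≤ l → l ≤ 2 → ‖iteratedDeriv l (fun s ↦ Lorentz.boostCLM (-v s)) w‖ ≤ δ₀) ∧ ‖Lorentz.boostCLM (-v w)‖ ≤ Ca :=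
  fun hκ₀ hvs hv _ hvV hξV hξ0 hv0 ↦ eventually_kinematics_small' hκ₀ hvs hv hvV hξV hξ0 hv0

end Summit.FinalStateConjecture.FinalStateConjecture.Theorems

end
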